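import Summits.ResolutionOfSingularities.ResolutionOfSingularities.Theorems.PurelyInseparableDim4ResConeLossyPairTail
import Summits.ResolutionOfSingularities.ResolutionOfSingularities.Theorems.PurelyInseparableDim4ResConePairReduction
import Summits.ResolutionOfSingularities.ResolutionOfSingularities.Theorems.PurelyInseparableDim4ResConeCornerWalls
import HarnessLib
import HarnessLib.Audit.Tags

/-!
# Purely inseparable four-folds — THE LEDGER OF A LOSSY PAIR TAIL: frozen tilt along a run, the chart-letter law with
# the passive mass, eventually constant passive multiplicities, and the isolation AXIS WINDOW
# (K2(p) lane, SLICE C (C16): generic bookkeeping for the D∞-type lossy residual; file-holder res-dim4-p-5 g3)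

[OURS · counted 0 · cell `res-dim4-pi` · K2(p) lane (desk WORDS #78 (d), #80 (d), #96 (b), #105 (d)) · seat p-5 g3.]
Nothing here proves K2(p), `NoIsolatedTrap p p` or resolution of singularities in dimension ≥ 4 / char. `p`.

Setting of `…LossyPairTail`: an isolated above-floor witnessed `Step0 p` chain with `x^{r₀} ∣ F₀`, constant
`(d, e_G = 2)` from `k₀`, chart letters in `{a, a′}` (no permanence, losses allowed).
* `tilt_persists` — (I2) in frame form: a kernel vector `e_{a′} + ψ` (`ψ_a = 0`) survives every step with chart `a`:
  the other letter's tilt is FROZEN along a run;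
* `reentry_translation_eq` — after a run of `a`-steps, a re-entry step with chart `a′` keeping `a` translates the
  passive letters EXACTLY by the frozen tilt `ψ` (idea-4's «forced direction at (2)»);
* `r_chart_succ_add` — the chart-letter law with the passive mass `P_k = degIn (others) r_k`:
  `r_{k+1}(j k) + p = r_k a + r_k a′ + P_k + d`;
* `passive_eventually_const` — from some `k₁ ≥ k₀` on every passive multiplicity is constant and every translated
  passive letter is free (passive letters are shed at most once, `…LightPairTail.free_of_translated`);
* `exists_mem_support_offAxis_lt` / `offAxis_mass_lt` — the isolation AXIS WINDOW at every state: for each letter `i`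
  some monomial `x^e` of `F` has off-axis mass `Σ_{l ≠ i} e_l < p`, hence `Σ_{l ≠ i} r_l < p`
  (`…CornerWalls.ordAlong_erase_lt_of_isIsolated`).
[cite: CossartJannsenSaito2020, Thm. 3.10(4), Thm. 3.14, Thm. 9.3] [cite: HauserPerlega2019PRIMS, §2 (transform D′ of D)]
bears_on: LADDER-RESOLUTION:D157-DOOR2 (res-dim4-pi · K2(p) = `RidgeBudget.NoAboveFloorTrap p p` · slice C, lossy residual).
Supports stmt-ResolutionOfSingularities-16155 (helper).
-/

set_option linter.dupNamespace false -- mandated namespace of this single-conjunct summit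

noncomputable section

namespace Summit.ResolutionOfSingularities.ResolutionOfSingularities.Theorems.PIDim4

namespace ResCone

open MvPolynomial Finset
open Literature.AlgebraicGeometry.Resolution
open Literature.AlgebraicGeometry.Resolution.CentreBlowup
open Literature.AlgebraicGeometry.Resolution.Hauser2010
open Literature.AlgebraicGeometry.Resolution.HauserPerlega2019

variable {K : Type} [Field K]

section Ledger

variable (p : ℕ) [Fact p.Prime] [CharP K p] [DecidableEq K]

omit [CharP K p] in
/-- **THE OTHER LETTER'S TILT IS FROZEN ALONG A RUN** ((I2) in frame form): on a constant-`(d, e_G = 2)` tail, a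
kernel vector `w` with `w (j k) = 0` at time `k` is again a kernel vector at time `k + 1`; in particular
`e_{a′} + ψ ∈ resVertex (c k)` with `ψ a = 0` and `j k = a` gives `e_{a′} + ψ ∈ resVertex (c (k+1))`. [OURS]
[cite: CossartJannsenSaito2020, Thm. 3.10(4), Thm. 9.3] -/
theorem tilt_persists {c : ℕ → State K} {j : ℕ → Fin 4} {b : ℕ → Fin 4 → K}
    (hc : ∀ k, IsIsolated p (c k).F ∧ Step0 p (c k) (c (k + 1))) (hw : FreeTail.IsWitnessedChain p c j b)
    (hr0 : ∀ e ∈ (c 0).F.support, (c 0).r ≤ e) (hfloor : ∀ k, ordZero (c k).F ≠ p) {k₀ : ℕ} {d : ℕ∞}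
    (hshade : ∀ k, k₀ ≤ k → (c k).shade = d) (he : ∀ k, k₀ ≤ k → Module.finrank K (resVertex (c k)) = 2)
    {k : ℕ} (hk : k₀ ≤ k) {w : Fin 4 → K} (hwV : w ∈ resVertex (c k)) (hwj : w (j k) = 0) :
    w ∈ resVertex (c (k + 1)) := by
  have hI2 := chain_resVertex_step_inf_hyperplane_eq p hc hw hr0 hfloor hshade he hk
  have hmem : w ∈ resVertex (c k) ⊓ hyperplane (j k) := Submodule.mem_inf.mpr ⟨hwV, mem_hyperplane.mpr hwj⟩
  rw [← hI2] at hmem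
  exact (Submodule.mem_inf.mp hmem).1

omit [CharP K p] in
/-- Frozen tilt along a whole run of the letter `a`: if `j t = a` for `k ≤ t < m` then a kernel vector `w` with
`w a = 0` at time `k` is a kernel vector at every time `t ∈ [k, m]`. [OURS] [cite: CossartJannsenSaito2020, Thm. 9.3] -/
theorem tilt_persists_run {c : ℕ → State K} {j : ℕ → Fin 4} {b : ℕ → Fin 4 → K}
    (hc : ∀ k, IsIsolated p (c k).F ∧ Step0 p (c k) (c (k + 1))) (hw : FreeTail.IsWitnessedChain p c j b)
    (hr0 : ∀ e ∈ (c 0).F.support, (c 0).r ≤ e) (hfloor : ∀ k, ordZero (c k).F ≠ p) {k₀ : ℕ} {d : ℕ∞}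
    (hshade : ∀ k, k₀ ≤ k → (c k).shade = d) (he : ∀ k, k₀ ≤ k → Module.finrank K (resVertex (c k)) = 2)
    {a : Fin 4} {k m : ℕ} (hk : k₀ ≤ k) (hrun : ∀ t, k ≤ t → t < m → j t = a) {w : Fin 4 → K}
    (hwV : w ∈ resVertex (c k)) (hwa : w a = 0) : ∀ t, k ≤ t → t ≤ m → w ∈ resVertex (c t) := by
  intro t hkt htm
  induction t, hkt using Nat.le_induction with
  | base => exact hwV
  | succ t hkt ih =>
    have hjt : j t = a := hrun t hkt (by omega)
    exact tilt_persists p hc hw hr0 hfloor hshade he (by omega) (ih (by omega)) (by rw [hjt]; exact hwa)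

/-- **THE RE-ENTRY TRANSLATION IS THE FROZEN TILT** (idea-4's «forced direction at (2)», every `p`, `d`): if
`e_{a′} + ψ` is a kernel vector at time `k` (`ψ` vanishing on `{a, a′}`), the steps `k, …, m − 1` have chart `a`, and
step `m` has chart `a′` and keeps `a` (`b m a = 0`), then the passive part of the translation at `m` IS `ψ`:
`b m i = ψ i` for every passive `i`. [OURS] [cite: CossartJannsenSaito2020, Thm. 3.10(4), Thm. 3.14, Thm. 9.3] -/
theorem reentry_translation_eq {c : ℕ → State K} {j : ℕ → Fin 4} {b : ℕ → Fin 4 → K}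
    (hc : ∀ k, IsIsolated p (c k).F ∧ Step0 p (c k) (c (k + 1))) (hw : FreeTail.IsWitnessedChain p c j b)
    (hr0 : ∀ e ∈ (c 0).F.support, (c 0).r ≤ e) (hfloor : ∀ k, ordZero (c k).F ≠ p) {k₀ : ℕ} {d : ℕ∞}
    (hshade : ∀ k, k₀ ≤ k → (c k).shade = d) (he : ∀ k, k₀ ≤ k → Module.finrank K (resVertex (c k)) = 2)
    {a a' : Fin 4} (haa : a ≠ a') (hletters : ∀ k, k₀ ≤ k → (j k = a ∨ j k = a')) {k m : ℕ} (hk : k₀ ≤ k)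
    (hkm : k ≤ m) (hrun : ∀ t, k ≤ t → t < m → j t = a) (hjm : j m = a') (hbma : b m a = 0) {ψ : Fin 4 → K}
    (hψa : ψ a = 0) (hψa' : ψ a' = 0) (hψV : Pi.single a' 1 + ψ ∈ resVertex (c k)) {i : Fin 4} (hia : i ≠ a)
    (hia' : i ≠ a') : b m i = ψ i := by
  have hψm : Pi.single a' 1 + ψ ∈ resVertex (c m) :=
    tilt_persists_run p hc hw hr0 hfloor hshade he hk hrun hψV
      (by rw [Pi.add_apply, Pi.single_eq_of_ne haa, hψa, zero_add]) m hkm le_rfl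
  obtain ⟨ψ', φ', -, -, hφ'a', hφ'a, -, hφ'V⟩ := exists_tilted_frame_at p hc hw hr0 hfloor hshade he haa.symm
    (fun k hk => (hletters k hk).symm) (k := m) (by omega) hjm
  have h := translation_forced p hc hw hr0 hfloor hshade he haa.symm (fun k hk => (hletters k hk).symm)
    (k := m) (by omega) hjm hψa' hψa hφ'a' hφ'a hψm hφ'V hia' hia
  rw [hbma, zero_mul, add_zero] at h
  exact h

omit [CharP K p] in
/-- **THE CHART-LETTER LAW WITH THE PASSIVE MASS**: at a step with chart `a` of a constant-shade state with `o > p`,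
`r_{k+1} a + p = r_k a + r_k a′ + degIn (others) r_k + d`. [cite: HauserPerlega2019PRIMS, §2 (transform D′ of D)] -/
theorem r_chart_succ_add {c : ℕ → State K} {j : ℕ → Fin 4} {b : ℕ → Fin 4 → K}
    (hc : ∀ k, IsIsolated p (c k).F ∧ Step0 p (c k) (c (k + 1))) (hw : FreeTail.IsWitnessedChain p c j b)
    (hr0 : ∀ e ∈ (c 0).F.support, (c 0).r ≤ e) (hfloor : ∀ k, ordZero (c k).F ≠ p) {d : ℕ} {k : ℕ}
    (hshade : (c k).shade = (d : ℕ∞)) {a a' : Fin 4} (haa : a ≠ a') (hjk : j k = a) :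
    (c (k + 1)).r a + p = (c k).r a + (c k).r a' + degIn ((Finset.univ.erase a).erase a') (c k).r + d := by
  obtain ⟨o, ho, hpo, -⟩ := chain_band p hc hfloor k
  have hrk := IsolatedBand.isolated_chain_forall_le hc hr0 k
  have hdeg := degree_r_le ho hrk
  have hd := ordZero_sub_degree_eq_of_shade ho hshade
  rw [(hw k).2.2.2.2, step_r_univ p (j k) (hw k).2.1 (c k) ho hrk, hjk, Finsupp.coe_update, Function.update_self,
    ← degree_eq_apply_add_apply_add_degIn haa]
  omega

omit [CharP K p] in
/-- **PASSIVE MULTIPLICITIES ARE EVENTUALLY CONSTANT** on a tail with chart letters in `{a, a′}`: from some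
`k₁ ≥ k₀` on, every passive letter keeps its multiplicity, and a passive letter that is translated is free.
(Each passive letter is shed at most once and never re-created.) [OURS] [cite: CossartJannsenSaito2020, Thm. 3.14] -/
theorem passive_eventually_const {c : ℕ → State K} {j : ℕ → Fin 4} {b : ℕ → Fin 4 → K}
    (hc : ∀ k, IsIsolated p (c k).F ∧ Step0 p (c k) (c (k + 1))) (hw : FreeTail.IsWitnessedChain p c j b)
    (hr0 : ∀ e ∈ (c 0).F.support, (c 0).r ≤ e) (hfloor : ∀ k, ordZero (c k).F ≠ p) {k₀ : ℕ} {a a' : Fin 4}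
    (haa : a ≠ a') (hletters : ∀ k, k₀ ≤ k → (j k = a ∨ j k = a')) :
    ∃ k₁, k₀ ≤ k₁ ∧ ∀ k, k₁ ≤ k → ∀ i, i ≠ a → i ≠ a' →
      (c k).r i = (c k₁).r i ∧ (b k i ≠ 0 → (c k).r i = 0) := by
  classical
  -- for ONE passive letter: a threshold after which it is constant and free-if-translated
  have hone : ∀ i, i ≠ a → i ≠ a' → ∃ k₁, k₀ ≤ k₁ ∧ ∀ k, k₁ ≤ k →
      (c (k + 1)).r i = (c k).r i ∧ (b k i ≠ 0 → (c k).r i = 0) := by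
    intro i hia hia'
    have hij : ∀ k, k₀ ≤ k → i ≠ j k := fun k hk => by
      rcases hletters k hk with h | h <;> rw [h]
      · exact hia
      · exact hia'
    by_cases hex : ∃ k, k₀ ≤ k ∧ b k i ≠ 0
    · obtain ⟨t, ht, hbt⟩ := hex
      have hfree := free_of_translated p hc hw hr0 hfloor hletters hia hia' ht hbt
      refine ⟨t + 1, by omega, fun k hk => ⟨?_, fun _ => (hfree k hk).1⟩⟩
      rw [(hfree (k + 1) (by omega)).1, (hfree k hk).1]
    · push Not at hex
      refine ⟨k₀, le_rfl, fun k hk => ⟨?_, fun hb => absurd (hex k hk) hb⟩⟩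
      exact step_r_apply_of_untranslated p hc hw hr0 hfloor (hij k hk) (hex k hk)
  obtain ⟨f₁, f₂, hf₁₂, hf₁a, hf₁a', hf₂a, hf₂a', hcompl⟩ := exists_pair_compl haa
  obtain ⟨t₁, ht₁, h₁⟩ := hone f₁ hf₁a hf₁a'
  obtain ⟨t₂, ht₂, h₂⟩ := hone f₂ hf₂a hf₂a'
  refine ⟨max t₁ t₂, by omega, fun k hk i hia hia' => ?_⟩
  have hi : i = f₁ ∨ i = f₂ := by
    by_contra hno
    push Not at hno
    rcases hcompl i hno.1 hno.2 with h | h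
    · exact hia h
    · exact hia' h
  have hconst : ∀ (g : ℕ → ℕ) (T : ℕ), (∀ k, T ≤ k → g (k + 1) = g k) → ∀ k, T ≤ k → g k = g T := by
    intro g T hg k hk
    induction k, hk using Nat.le_induction with
    | base => rfl
    | succ k hk ih => rw [hg k hk, ih]
  rcases hi with rfl | rfl
  · refine ⟨?_, (h₁ k (by omega)).2⟩
    rw [hconst (fun k => (c k).r i) t₁ (fun k hk => (h₁ k hk).1) k (by omega),
      hconst (fun k => (c k).r i) t₁ (fun k hk => (h₁ k hk).1) (max t₁ t₂) (by omega)]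
  · refine ⟨?_, (h₂ k (by omega)).2⟩
    rw [hconst (fun k => (c k).r i) t₂ (fun k hk => (h₂ k hk).1) k (by omega),
      hconst (fun k => (c k).r i) t₂ (fun k hk => (h₂ k hk).1) (max t₁ t₂) (by omega)]

omit [Fact p.Prime] [CharP K p] [DecidableEq K] in
/-- **THE ISOLATION AXIS WINDOW**: at an isolated `p`-fold point, for every letter `i` some monomial `x^e` of `F` has
off-axis mass `Σ_{l ≠ i} e_l < p` (the `x_i`-axis does not lie in the `p`-fold locus). [folklore]
[cite: CossartJannsenSaito2020, Thm. 3.14] -/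
theorem exists_mem_support_offAxis_lt {F : MvPolynomial (Fin 4) K} (hiso : IsIsolated p F) (i : Fin 4) :
    ∃ e ∈ F.support, degIn (Finset.univ.erase i) e < p :=
  exists_degIn_lt_of_ordAlong_lt (ordAlong_erase_lt_of_isIsolated hiso i)

omit [Fact p.Prime] [CharP K p] [DecidableEq K] in
/-- Hence the boundary multiplicities off every axis sum to `< p`: `Σ_{l ≠ i} r_l < p` when `x^r ∣ F` at an isolated
`p`-fold point. [folklore] [cite: CossartJannsenSaito2020, Thm. 3.14] -/
theorem offAxis_mass_lt {s : State K} (hiso : IsIsolated p s.F) (hr : ∀ e ∈ s.F.support, s.r ≤ e) (i : Fin 4) :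
    degIn (Finset.univ.erase i) s.r < p := by
  obtain ⟨e, he, hlt⟩ := exists_mem_support_offAxis_lt p hiso i
  exact lt_of_le_of_lt (Finset.sum_le_sum fun l _ => Finsupp.le_def.mp (hr e he) l) hlt

omit [Fact p.Prime] [CharP K p] in
/-- **On the chain**: at every state and for every letter, `Σ_{l ≠ i} (c k).r l < p`; in particular on a pair tail
`r_k a′ + degIn (others) r_k < p` (take `i = a`). [OURS · bookkeeping] [cite: CossartJannsenSaito2020, Thm. 3.14] -/
theorem chain_offAxis_mass_lt {c : ℕ → State K}
    (hc : ∀ k, IsIsolated p (c k).F ∧ Step0 p (c k) (c (k + 1))) (hr0 : ∀ e ∈ (c 0).F.support, (c 0).r ≤ e)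
    (k : ℕ) (i : Fin 4) : degIn (Finset.univ.erase i) (c k).r < p :=
  offAxis_mass_lt p (hc k).1 (IsolatedBand.isolated_chain_forall_le hc hr0 k) i

end Ledger

end ResCone

end Summit.ResolutionOfSingularities.ResolutionOfSingularities.Theorems.PIDim4

end
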